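import Literature.AlgebraicGeometry.Frobenioids.BirationalizationBiratData
import Literature.AlgebraicGeometry.Frobenioids.DivisorMonoidBirationalPerfectProofs
import HarnessLib

/-!
# Frobenioids I, Proposition 4.8 (i), (ii) AS TYPED (`Prop48i`, `Prop48ii`) hold for THE
# birationalization datum `biratData hF hsq`

Mochizuki, *The geometry of Frobenioids I: the general theory*, Kyushu J. Math. **62** (2008)
293–400, §4, Proposition 4.8 (i), (ii), kurims text p. 88 [cite: MochizukiFrdI2008, Prop. 4.8 p.88].
Seat abc-iut-L1-t3's named statements `PreFrobenioidData.Prop48i S B`, `PreFrobenioidData.Prop48ii S B`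
(`DivisorMonoidCategoryTheoreticityDefs.lean`) are predicates on a birationalization datum
`B : S.BiratData`; abc-iut-L6-t6's `PreFrobenioid.biratData hF hsq` (`BirationalizationBiratData.lean`)
instantiates the interface with THE birationalization of a Frobenioid `F` (seat abc-iut-L6-t8). The
mathematical content was proved in `DivisorMonoidBirationalTypesProofs.lean` (isotropic type) and
`DivisorMonoidBirationalPerfectProofs.lean` (perfect type); this file states the two named facts
literally for that datum (its `ops` are `ofFunctor 0_D (Birat.toElemZero hF hsq)` by definition).
PROOF-ONLY (no definitions). Nodes `FrdI:Prop4.8(i)`, `FrdI:Prop4.8(ii)` (abc-iut-L6-t20).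
-/

namespace Literature.AlgebraicGeometry.Frobenioids

open CategoryTheory Opposite

namespace PreFrobenioid

universe w v v' u u'

variable {D : Type u} [Category.{v} D] {Φ : Dᵒᵖ ⥤ CommMonCat.{w}}
  {C : Type u'} [Category.{v'} C] {F : C ⥤ ElemFrobenioid Φ}
  (hF : IsFrobenioid F) (hsq : HasBiratSquares F)

/-- **[FrdI] Prop. 4.8 (i)** AS TYPED (`Prop48i`) for THE birationalization datum of a Frobenioid: "If `C`
is of isotropic type, then so is `C^birat`." [cite: MochizukiFrdI2008, Prop. 4.8 (i) p.88] -/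
theorem prop48i_biratData : (PreFrobenioidData.ofFunctor Φ F).Prop48i (biratData hF hsq) :=
  fun h => PreFrobenioidData.isOfIsotropicType_ofFunctor_toElemZero hF hsq h

/-- **[FrdI] Prop. 4.8 (ii)** AS TYPED (`Prop48ii`) for THE birationalization datum of a Frobenioid:
"If `C` is of perfect and isotropic type, then so is `C^birat`." [cite: MochizukiFrdI2008, Prop. 4.8 (ii) p.88] -/
theorem prop48ii_biratData : (PreFrobenioidData.ofFunctor Φ F).Prop48ii (biratData hF hsq) :=
  fun hperf hiso => PreFrobenioidData.prop48ii_body_toElemZero hF hsq hperf hiso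

end PreFrobenioid

end Literature.AlgebraicGeometry.Frobenioids
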